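import Summits.ValiantsHypothesis.ValiantsHypothesis.Theorems.KPlusLogSqLawOctaveDominatedClasses

/-!
# Route «KPlusLogSqLaw», octave line — depth-free direction, step 2: the octave–Newton lemma (roots of ANY real polynomial occupy ≤ (2(⌊log₂ t⌋+1)+2)·#true-Newton-breaks octaves) and the typed candidate `NewtonBreakLifting`

HONEST FRAMING.  Prover seat val-width-19561-oc1 (re-target by director-valiant g9, 2026-08-27T23:36:52Z: «THEORY on the first depth-FREE piece toward Ω-W»), `--supports stmt-ValiantsHypothesis-19561`.  `OctaveWeakLifting` (Ω-W) is depth-free and OPEN; `WeakLifting` (stmt-19561), `TropicalB` (stmt-19771), Conjecture B are OPEN; the candidate statements `DeadClassLifting` and `NewtonBreakLifting` are DEFINED, NOT asserted.  Nothing here bears on their truth; VP ≠ VNP is not moved.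

This file: `newtonLog`, `newtonCross`, `newtonBreaks` (breakpoints of the TRUE archimedean Newton polygon), `root_near_newtonBreaks`, `octaveCount_le_newtonBreaks` (depth-free, design-free), `card_support_pencilDet_le`, `octaveCount_pencilDet_le_newtonBreaks` (Ω ≤ (2M+4)·#newtonBreaks for pencils), `NewtonBreakLifting` (NOT asserted) and `octaveCount_le_of_newtonBreakLifting`.
-/

set_option linter.dupNamespace false
set_option autoImplicit false

namespace Summit.ValiantsHypothesis.ValiantsHypothesis.Theorems.KPlusLogSqLaw.Octave

open Polynomial Finset
open scoped BigOperators

/-! ### The octave–Newton lemma (depth-free, design-free) -/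

section NewtonPolygon

open Finset Polynomial

/-- height of the exponent `e` in the archimedean Newton picture of `p`: `log₂ |coeff e|` (junk off the support, never used there). -/
noncomputable def newtonLog (p : ℝ[X]) (e : ℕ) : ℝ := Real.logb 2 |p.coeff e|

/-- crossing abscissa (in `θ = log₂|x|`) of the Newton lines `θ ↦ newtonLog p e + e θ` of two exponents. -/
noncomputable def newtonCross (p : ℝ[X]) (kl : ℕ × ℕ) : ℝ :=
  (newtonLog p kl.1 - newtonLog p kl.2) / ((kl.2 : ℝ) - kl.1)

open scoped Classical in
/-- **breakpoints of the TRUE archimedean Newton polygon** of `p`: abscissae where the lines of two distinct exponents of the support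
tie at the top of the envelope `θ ↦ max_{e ∈ supp p} (log₂|coeff e| + e θ)` (the vertices of the upper hull of the points
`(e, log₂|coeff e|)`, seen from the `θ` side).  Cancellation inside the pencil is already priced in: only live coefficients appear. -/
noncomputable def newtonBreaks (p : ℝ[X]) : Finset ℝ :=
  ((p.support ×ˢ p.support).filter (fun kl => kl.1 ≠ kl.2 ∧
      ∀ t ∈ p.support, newtonLog p t + t * newtonCross p kl ≤ newtonLog p kl.1 + kl.1 * newtonCross p kl)).image
    (newtonCross p)

/-- **roots sit near true Newton breakpoints**: every nonzero real root `x` of a nonzero real polynomial with `t` terms has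
`log₂|x|` within `⌊log₂ t⌋ + 1` of a breakpoint of its archimedean Newton polygon (at a root the top term is at most `t − 1` times the
runner-up of another exponent; integer slopes then force an envelope breakpoint within `log₂ t`).  `rawConfinement_oneClass` at depth `0`
on singleton classes + `envelopeGap`. [folklore] -/
theorem root_near_newtonBreaks (p : ℝ[X]) (x : ℝ) (hx0 : x ≠ 0) (hp : p ≠ 0) (hroot : p.IsRoot x) :
    ∃ b ∈ newtonBreaks p, |Real.logb 2 |x| - b| ≤ ((Nat.log 2 p.support.card + 1 : ℕ) : ℝ) := by
  classical
  set y := |x| with hy_def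
  have hy : 0 < y := abs_pos.2 hx0
  have hyne : y ≠ 0 := hy.ne'
  set u := x / |x| with hu_def
  have hu : u = 1 ∨ u = -1 := sign_div_abs x hx0
  have huy : u * y = x := by rw [hu_def, hy_def]; exact div_mul_cancel₀ x (abs_ne_zero.2 hx0)
  have hupow : ∀ n : ℕ, u ^ n = 1 ∨ u ^ n = -1 := fun n => by
    rcases hu with h | h
    · left; simp [h]
    · rw [h]; exact neg_one_pow_eq_or ℝ n
  -- the terms of `p` as a signed sum of monomials indexed by the support
  let ι := {e : ℕ // e ∈ p.support}
  have hcoef : ∀ e : ι, p.coeff e.1 ≠ 0 := fun e => Polynomial.mem_support_iff.1 e.2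
  let a : ι → ℝ := fun e => |p.coeff e.1|
  let sg : ι → ℝ := fun e => p.coeff e.1 / |p.coeff e.1| * u ^ e.1
  have hapos : ∀ e, 0 < a e := fun e => abs_pos.2 (hcoef e)
  have ha : ∀ e, 0 ≤ a e := fun e => (hapos e).le
  have hsg : ∀ e, sg e = 1 ∨ sg e = -1 := fun e => by
    simp only [sg]
    rcases sign_div_abs _ (hcoef e) with h1 | h1 <;> rcases hupow e.1 with h2 | h2 <;> simp [h1, h2]
  have hF1 : ∀ e, sg e * a e = p.coeff e.1 * u ^ e.1 := fun e => by
    have hne : |p.coeff e.1| ≠ 0 := abs_ne_zero.2 (hcoef e)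
    show p.coeff e.1 / |p.coeff e.1| * u ^ e.1 * |p.coeff e.1| = p.coeff e.1 * u ^ e.1
    rw [mul_assoc, mul_comm (u ^ e.1), ← mul_assoc, div_mul_cancel₀ _ hne]
  have hF2 : ∀ e, sg e * a e * y ^ e.1 = p.coeff e.1 * x ^ e.1 := fun e => by
    rw [hF1, mul_assoc, ← mul_pow, huy]
  have heval : p.eval x = ∑ e ∈ p.support, p.coeff e * x ^ e := by
    rw [Polynomial.eval_eq_sum, Polynomial.sum_def]
  have hroot' : ∑ e : ι, sg e * a e * y ^ e.1 = 0 := by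
    simp_rw [hF2]
    rw [Finset.sum_coe_sort p.support (fun e => p.coeff e * x ^ e), ← heval]
    exact hroot
  -- the top term
  obtain ⟨e₁, he₁⟩ : p.support.Nonempty := Polynomial.support_nonempty.2 hp
  obtain ⟨τ₀, -, hmax⟩ := Finset.exists_max_image (univ : Finset ι) (fun e => a e * y ^ e.1) ⟨⟨e₁, he₁⟩, mem_univ _⟩
  -- singleton classes: depth 0
  have hclass : univ.filter (fun e : ι => e.1 = τ₀.1) = {τ₀} := by
    ext e
    simp only [mem_filter, mem_univ, true_and, mem_singleton]
    exact Subtype.ext_iff.symm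
  have hdepth : (∑ e ∈ univ.filter (fun e : ι => e.1 = τ₀.1), a e) ≤
      (2 : ℝ) ^ (0 : ℕ) * |∑ e ∈ univ.filter (fun e : ι => e.1 = τ₀.1), sg e * a e| := by
    rw [hclass, sum_singleton, sum_singleton, pow_zero, one_mul, abs_mul, abs_of_pos (hapos τ₀)]
    have : |sg τ₀| = 1 := by rcases hsg τ₀ with h | h <;> simp [h]
    rw [this, one_mul]
  obtain ⟨τ₁, hs₁, hconf⟩ := rawConfinement_oneClass (fun e : ι => e.1) a ha sg hsg 0 y hy hroot' τ₀ (hapos τ₀) hdepth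
  rw [pow_zero, mul_one] at hconf
  set N := Fintype.card ι with hN
  have hNcard : N = p.support.card := by rw [hN]; exact Fintype.card_coe p.support
  have hNpos : 0 < (N : ℝ) := by
    have : 0 < N := Fintype.card_pos_iff.2 ⟨τ₀⟩
    exact_mod_cast this
  -- logs
  set θ := Real.logb 2 y with hθ
  have hlog_line : ∀ e : ι, Real.logb 2 (a e * y ^ e.1) = newtonLog p e.1 + ((e.1 : ℕ) : ℤ) * θ := by
    intro e
    rw [Real.logb_mul (hapos e).ne' (pow_ne_zero _ hyne), Real.logb_pow, newtonLog]
    push_cast; ring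
  have htop : ∀ k : ι, newtonLog p k.1 + ((k.1 : ℕ) : ℤ) * θ ≤ newtonLog p τ₀.1 + ((τ₀.1 : ℕ) : ℤ) * θ := by
    intro k
    rw [← hlog_line k, ← hlog_line τ₀]
    exact Real.logb_le_logb_of_le (by norm_num) (mul_pos (hapos k) (pow_pos hy _)) (hmax k (mem_univ _))
  have hnear : newtonLog p τ₀.1 + ((τ₀.1 : ℕ) : ℤ) * θ ≤ newtonLog p τ₁.1 + ((τ₁.1 : ℕ) : ℤ) * θ + Real.logb 2 N := by
    rw [← hlog_line τ₀, ← hlog_line τ₁]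
    have h1 := Real.logb_le_logb_of_le (b := 2) (by norm_num) (mul_pos (hapos τ₀) (pow_pos hy _)) hconf
    have h2 : Real.logb 2 (N * (a τ₁ * y ^ τ₁.1)) = Real.logb 2 N + Real.logb 2 (a τ₁ * y ^ τ₁.1) :=
      Real.logb_mul hNpos.ne' (mul_pos (hapos τ₁) (pow_pos hy _)).ne'
    linarith
  have hs₁' : ((τ₀.1 : ℕ) : ℤ) ≠ ((τ₁.1 : ℕ) : ℤ) := by exact_mod_cast (Ne.symm hs₁)
  obtain ⟨b, hb, k, l, hkl, htie, hall⟩ := envelopeGap (ι := ι) (fun e => ((e.1 : ℕ) : ℤ)) (fun e => newtonLog p e.1)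
    (Real.logb 2 N) θ τ₀ τ₁ hs₁' htop hnear
  have hkl' : (k.1 : ℝ) ≠ l.1 := by
    intro h; apply hkl; exact_mod_cast (show (k.1 : ℕ) = l.1 by exact_mod_cast h)
  have hklN : (k.1 : ℕ) ≠ l.1 := fun h => hkl (by rw [h])
  have hbcross : newtonCross p (k.1, l.1) = b := by
    rw [newtonCross]
    have htie' : newtonLog p k.1 + (k.1 : ℝ) * b = newtonLog p l.1 + (l.1 : ℝ) * b := by
      simpa [Int.cast_natCast] using htie
    rw [div_eq_iff (sub_ne_zero.2 (Ne.symm hkl'))]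
    linarith
  refine ⟨b, ?_, ?_⟩
  · rw [newtonBreaks, Finset.mem_image]
    refine ⟨(k.1, l.1), ?_, hbcross⟩
    rw [Finset.mem_filter]
    refine ⟨Finset.mem_product.2 ⟨k.2, l.2⟩, hklN, fun t ht => ?_⟩
    rw [hbcross]
    have := hall ⟨t, ht⟩
    simpa [Int.cast_natCast] using this
  · calc |θ - b| ≤ Real.logb 2 N := hb
      _ ≤ ((Nat.log 2 p.support.card + 1 : ℕ) : ℝ) := by
          rw [hNcard]
          have h1 : (p.support.card : ℝ) < (2 : ℝ) ^ (Nat.log 2 p.support.card + 1) := by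
            exact_mod_cast Nat.lt_pow_succ_log_self (b := 2) (by norm_num) p.support.card
          have h2 := Real.logb_lt_logb (b := 2) (by norm_num) (by rw [← hNcard]; exact hNpos) h1
          rw [Real.logb_pow, Real.logb_self_eq_one (by norm_num), mul_one] at h2
          push_cast at h2 ⊢
          linarith

/-- **the octave–Newton lemma**: a real polynomial with `t` terms has nonzero real roots in at most `(2(⌊log₂ t⌋+1)+2) · #breaks`
dyadic octaves, `#breaks` = the number of breakpoints of its TRUE archimedean Newton polygon.  Depth-free and design-free; the count
of octaves (unlike the count of roots) is immune to clustering. [folklore] -/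
theorem octaveCount_le_newtonBreaks (p : ℝ[X]) :
    octaveCount p ≤ (2 * (Nat.log 2 p.support.card + 1) + 2) * (newtonBreaks p).card :=
  cellCount_proof p (newtonBreaks p) (Nat.log 2 p.support.card + 1) fun x hx hp hr => root_near_newtonBreaks p x hx hp hr

variable {m K : ℕ}

/-- a pencil determinant of format `(m, K)` has at most `2^{m(⌊log₂(mK)⌋+1)}` terms (one slope class per raw Leibniz term at most). -/
theorem card_support_pencilDet_le (d : Fin K → ℕ) (S : Fin K → Matrix (Fin m) (Fin m) ℝ) :
    (pencilDet d S).support.card ≤ 2 ^ (m * (Nat.log 2 (m * K) + 1)) := by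
  classical
  have hsub : (pencilDet d S).support ⊆ (univ : Finset (RawTerm m K)).image (rawSlope d) := by
    intro e he
    rw [Polynomial.mem_support_iff, coeff_pencilDet_eq_sum] at he
    obtain ⟨τ, hτ, -⟩ := Finset.exists_ne_zero_of_sum_ne_zero he
    exact mem_image.2 ⟨τ, mem_univ _, (mem_filter.1 hτ).2⟩
  calc (pencilDet d S).support.card ≤ ((univ : Finset (RawTerm m K)).image (rawSlope d)).card := card_le_card hsub
    _ ≤ (univ : Finset (RawTerm m K)).card := card_image_le
    _ = Fintype.card (RawTerm m K) := Finset.card_univ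
    _ ≤ 2 ^ (m * (Nat.log 2 (m * K) + 1)) := card_rawTerm_le m K

/-- **octaves of a pencil determinant against its TRUE Newton polygon** (depth-free): at most `(2(M+1)+2) · #newtonBreaks` octaves,
`M = m(⌊log₂(mK)⌋+1)`.  The whole depth-free crux Ω-W is therefore «true Newton breakpoints vs the tropical row». [folklore] -/
theorem octaveCount_pencilDet_le_newtonBreaks (d : Fin K → ℕ) (S : Fin K → Matrix (Fin m) (Fin m) ℝ) :
    octaveCount (pencilDet d S) ≤ (2 * (m * (Nat.log 2 (m * K) + 1) + 1) + 2) * (newtonBreaks (pencilDet d S)).card := by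
  refine (octaveCount_le_newtonBreaks _).trans (Nat.mul_le_mul_right _ ?_)
  have h : Nat.log 2 (pencilDet d S).support.card ≤ m * (Nat.log 2 (m * K) + 1) :=
    calc Nat.log 2 (pencilDet d S).support.card ≤ Nat.log 2 (2 ^ (m * (Nat.log 2 (m * K) + 1))) :=
          Nat.log_mono_right (card_support_pencilDet_le d S)
      _ = m * (Nat.log 2 (m * K) + 1) := Nat.log_pow one_lt_two _
  omega

/-- **Newton-break lifting** (depth-free candidate statement, DEFINED, NOT asserted): the unsigned tropical row bounds the number of
breakpoints of the TRUE Newton polygon of every real pencil determinant of the format, with slack `2^{C(K + ⌊log₂ m⌋²)}`; by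
`octaveCount_pencilDet_le_newtonBreaks` it bounds octave counts with the extra factor `2M + 4`.  Why it might fail: FLAT vertices
(raw multiplicities and shallow cancellation perturb collinear class-tops into many nearly collinear true vertices) and MASKED POCKETS
(dead or deep classes hide live class-tops) both create true breakpoints the design envelope does not have. -/
def NewtonBreakLifting : Prop :=
  ∃ C : ℕ, ∀ (m K n : ℕ), Summit.ValiantsHypothesis.ValiantsHypothesis.Theorems.KPlusLogSqLaw.TropRowD m K n →
    ∀ (d : Fin K → ℕ) (S : Fin K → Matrix (Fin m) (Fin m) ℝ),
      (newtonBreaks (pencilDet d S)).card ≤ 2 ^ (C * (K + Nat.log 2 m ^ 2)) * (n + 1)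

/-- what Newton-break lifting would give for octaves (composition with the octave–Newton lemma). [folklore] -/
theorem octaveCount_le_of_newtonBreakLifting (h : NewtonBreakLifting) :
    ∃ C : ℕ, ∀ (m K n : ℕ), Summit.ValiantsHypothesis.ValiantsHypothesis.Theorems.KPlusLogSqLaw.TropRowD m K n →
      ∀ (d : Fin K → ℕ) (S : Fin K → Matrix (Fin m) (Fin m) ℝ),
        octaveCount (pencilDet d S) ≤
          (2 * (m * (Nat.log 2 (m * K) + 1) + 1) + 2) * (2 ^ (C * (K + Nat.log 2 m ^ 2)) * (n + 1)) := by
  obtain ⟨C, hC⟩ := h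
  exact ⟨C, fun m K n hT d S => (octaveCount_pencilDet_le_newtonBreaks d S).trans (Nat.mul_le_mul_left _ (hC m K n hT d S))⟩

end NewtonPolygon

end Summit.ValiantsHypothesis.ValiantsHypothesis.Theorems.KPlusLogSqLaw.Octave
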